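import Summits.Ventures.PercRepro.ProfileGapMonoColoopBandSucc

/-!
# PercRepro — THE COLOOP CASE OF THE THRESHOLD FAMILY (p5, gen 23; `proofs/P5-GM1.md` §21(m‴); announced
INBOX 11585)

At a coloop `z` of `N` (`N' := N ∖ z`) every set avoiding `z` has its complement rank raised by one and every set
through `z` has the rank of its `z`-free part raised by one, so the threshold demand splits exactly as
`thresholdSum N q t = thresholdSum N' q (t−1) + #{B : ρ'(B) = q−1, ρ'(E'∖B) ≥ t} + thresholdSum N' (q−1) t`
and the supply as `#T_t(N) = #T_{t−1}^{(q)}(N') + #T_t^{(q−1)}(N')`; the middle set of the demand IS `T_t^{(q−1)}(N')`,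
and the unit of slack `q − (q−1)` of the second statement pays for it: `(I_t)(N)` follows from `(I_{t−1})` at co-rank
`q` and `(I_t)` at co-rank `q − 1` for `N'` — the two statements at the offsets `t − q ∓ 1`.  A coloop is a bad
deletion point for the rule (the rank drops) but a good induction point.

* `rk_sdiff_of_notMem_coloop`, `rk_sdiff_insert_coloop`, `filter_Rq_eq_levelSetCoQ`, **`thresholdSum_coloop`**,
  `levelSetCoQ_union_lostSets_eq`, **`card_levelSetCoQ_coloop'`**, **`thresholdIneq_of_coloop`**.
-/

open scoped Matroid

namespace PercRepro.Cogirth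

open Finset ThmH Skew Shadow Profile

variable {α : Type} [DecidableEq α] {M : Matroid α} [M.Finite]

section ThresholdColoop

variable {N : Matroid α} [N.Finite] {z : α} {q t : ℕ} (hz : z ∈ gr N)
  (hzc : rk N ((gr N).erase z) + 1 = rk N (gr N))

include hz hzc in
/-- The complement of a set `B ∌ z` has `N`-rank one more than its `N ∖ z`-rank (`z` a coloop). -/
theorem rk_sdiff_of_notMem_coloop {B : Finset α} (hzB : z ∉ B) :
    rk N (gr N \ B) = rk (N ＼ ({z} : Set α)) (gr (N ＼ ({z} : Set α)) \ B) + 1 := by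
  have h1 : gr N \ B = insert z ((gr N).erase z \ B) := by
    ext x
    simp only [mem_sdiff, mem_insert, mem_erase]
    constructor
    · rintro ⟨hx, hxB⟩
      by_cases hxz : x = z
      · exact Or.inl hxz
      · exact Or.inr ⟨⟨hxz, hx⟩, hxB⟩
    · rintro (rfl | ⟨⟨_, hx⟩, hxB⟩)
      · exact ⟨hz, hzB⟩
      · exact ⟨hx, hxB⟩
  rw [h1, rk_insert_coloop hz hzc sdiff_subset, gr_delete', rk_delete sdiff_subset]

/-- The complement of a set through `z` is its complement in `N ∖ z`. -/
theorem rk_sdiff_insert_coloop {B' : Finset α} :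
    rk N (gr N \ insert z B') = rk (N ＼ ({z} : Set α)) (gr (N ＼ ({z} : Set α)) \ B') := by
  have h1 : gr N \ insert z B' = (gr N).erase z \ B' := by
    ext x
    simp only [mem_sdiff, mem_insert, mem_erase, not_or]
    tauto
  rw [h1, gr_delete', rk_delete sdiff_subset]

/-- The rank-`k` sets of co-rank `≥ s` are `levelSetCoQ s k`. -/
theorem filter_Rq_eq_levelSetCoQ (K : Matroid α) [K.Finite] (k s : ℕ) :
    (Rq K k).filter (fun B => s ≤ rk K (gr K \ B)) = levelSetCoQ K s k := by
  ext B
  rw [mem_filter, mem_Rq, mem_levelSetCoQ]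

include hz hzc in
/-- **The threshold demand at a coloop splits**: `thresholdSum N q t = thresholdSum N' q (t−1) + #T_t^{(q−1)}(N') +
thresholdSum N' (q−1) t` (`2 ≤ q`, `1 ≤ t`). -/
theorem thresholdSum_coloop (hq : 2 ≤ q) (ht : 1 ≤ t) :
    thresholdSum N q t =
      thresholdSum (N ＼ ({z} : Set α)) q (t - 1) + (levelSetCoQ (N ＼ ({z} : Set α)) t (q - 1)).card +
        thresholdSum (N ＼ ({z} : Set α)) (q - 1) t := by
  have e1 : t - 1 + 1 = t := by omega
  have e2 : q - 1 - 1 = q - 2 := by omega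
  have hsplit : thresholdSum N q t =
      ∑ B ∈ (Rq N (q - 1)).filter (fun B => z ∈ B),
          (if t + 1 ≤ rk N (gr N \ B) then rk N (gr N \ B) else 0) +
        ∑ B ∈ (Rq N (q - 1)).filter (fun B => z ∉ B),
          (if t + 1 ≤ rk N (gr N \ B) then rk N (gr N \ B) else 0) := by
    unfold thresholdSum
    rw [sum_filter_add_sum_filter_not]
  -- the sets through `z`
  have hthru : ∑ B ∈ (Rq N (q - 1)).filter (fun B => z ∈ B),
      (if t + 1 ≤ rk N (gr N \ B) then rk N (gr N \ B) else 0) =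
      thresholdSum (N ＼ ({z} : Set α)) (q - 1) t := by
    rw [Rq_filter_mem_eq_image_delete hz hzc (by omega : 1 ≤ q - 1)]
    have hinj : Set.InjOn (insert z)
        ((Rq (N ＼ ({z} : Set α)) (q - 1 - 1) : Finset (Finset α)) : Set (Finset α)) := by
      intro B₁ hB₁ B₂ hB₂ heq
      have hz₁ : z ∉ B₁ := by
        have := (mem_Rq.1 hB₁).1
        rw [gr_delete'] at this
        exact fun h => (mem_erase.1 (this h)).1 rfl
      have hz₂ : z ∉ B₂ := by
        have := (mem_Rq.1 hB₂).1
        rw [gr_delete'] at this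
        exact fun h => (mem_erase.1 (this h)).1 rfl
      rw [← erase_insert hz₁, ← erase_insert hz₂]
      exact congrArg (fun S => S.erase z) heq
    rw [sum_image hinj]
    unfold thresholdSum
    rw [e2]
    refine sum_congr rfl (fun B' _ => ?_)
    rw [rk_sdiff_insert_coloop]
  -- the sets avoiding `z`
  have hfree : ∑ B ∈ (Rq N (q - 1)).filter (fun B => z ∉ B),
      (if t + 1 ≤ rk N (gr N \ B) then rk N (gr N \ B) else 0) =
      thresholdSum (N ＼ ({z} : Set α)) q (t - 1) + (levelSetCoQ (N ＼ ({z} : Set α)) t (q - 1)).card := by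
    rw [← Rq_delete_eq_filter, ← filter_Rq_eq_levelSetCoQ, card_filter]
    unfold thresholdSum
    rw [e1, ← sum_add_distrib]
    refine sum_congr rfl (fun B hB => ?_)
    have hzB : z ∉ B := by
      have := (mem_Rq.1 hB).1
      rw [gr_delete'] at this
      exact fun h => (mem_erase.1 (this h)).1 rfl
    rw [rk_sdiff_of_notMem_coloop hz hzc hzB]
    split_ifs <;> omega
  rw [hsplit, hthru, hfree]
  ring

/-- The co-rank-`t` sets together with the lost sets (complement rank exactly `t − 1`) are the co-rank-`(t−1)`
sets (`1 ≤ t`). -/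
theorem levelSetCoQ_union_lostSets_eq (K : Matroid α) [K.Finite] (ht : 1 ≤ t) (k : ℕ) :
    levelSetCoQ K t k ∪ lostSets K t k = levelSetCoQ K (t - 1) k := by
  ext S
  unfold lostSets
  rw [mem_union, mem_levelSetCoQ, mem_levelSetCoQ, mem_filter, mem_levelSet]
  constructor
  · rintro (⟨h1, h2⟩ | ⟨h1, h2⟩)
    · exact ⟨h1, by omega⟩
    · exact ⟨h1, by omega⟩
  · rintro ⟨h1, h2⟩
    by_cases h3 : t ≤ rk K (gr K \ S)
    · exact Or.inl ⟨h1, h3⟩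
    · exact Or.inr ⟨h1, by omega⟩

include hz hzc in
/-- **The supply at a coloop splits**: `#T_t^{(q)}(N) = #T_{t−1}^{(q)}(N') + #T_t^{(q−1)}(N')` (`1 ≤ q`, `1 ≤ t`). -/
theorem card_levelSetCoQ_coloop' (hq : 1 ≤ q) (ht : 1 ≤ t) :
    (levelSetCoQ N t q).card =
      (levelSetCoQ (N ＼ ({z} : Set α)) (t - 1) q).card + (levelSetCoQ (N ＼ ({z} : Set α)) t (q - 1)).card := by
  rw [card_levelSetCoQ_coloop hz hzc ht hq, ← levelSetCoQ_union_lostSets_eq _ ht q]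
  have hdisj : Disjoint (levelSetCoQ (N ＼ ({z} : Set α)) t q) (lostSets (N ＼ ({z} : Set α)) t q) := by
    rw [disjoint_left]
    intro S hS hS'
    rw [mem_levelSetCoQ] at hS
    unfold lostSets at hS'
    rw [mem_filter] at hS'
    omega
  rw [card_union_of_disjoint hdisj]
  ring

include hz hzc in
/-- **`(I_t)` at a coloop from the two statements of the deletion** (`2 ≤ q`, `1 ≤ t`): `(I_{t−1})` at co-rank `q`
and `(I_t)` at co-rank `q − 1` for `N ∖ z`; the middle term `#T_t^{(q−1)}(N')` of the demand is paid by the unit of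
slack of the second. -/
theorem thresholdIneq_of_coloop (hq : 2 ≤ q) (ht : 1 ≤ t)
    (h1 : ThresholdIneq (N ＼ ({z} : Set α)) q (t - 1))
    (h2 : ThresholdIneq (N ＼ ({z} : Set α)) (q - 1) t) : ThresholdIneq N q t := by
  unfold ThresholdIneq at h1 h2 ⊢
  rw [thresholdSum_coloop hz hzc hq ht, card_levelSetCoQ_coloop' hz hzc (by omega) ht]
  have hq' : (q - 1) * (levelSetCoQ (N ＼ ({z} : Set α)) t (q - 1)).card +
      (levelSetCoQ (N ＼ ({z} : Set α)) t (q - 1)).card =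
      q * (levelSetCoQ (N ＼ ({z} : Set α)) t (q - 1)).card := by
    have hq1 : q - 1 + 1 = q := Nat.sub_add_cancel (by omega : 1 ≤ q)
    calc (q - 1) * (levelSetCoQ (N ＼ ({z} : Set α)) t (q - 1)).card +
          (levelSetCoQ (N ＼ ({z} : Set α)) t (q - 1)).card
        = (q - 1 + 1) * (levelSetCoQ (N ＼ ({z} : Set α)) t (q - 1)).card := by ring
      _ = q * (levelSetCoQ (N ＼ ({z} : Set α)) t (q - 1)).card := by rw [hq1]
  rw [Nat.mul_add]
  omega

end ThresholdColoop

end PercRepro.Cogirth
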